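import Summits.NavierStokesRegularity.FluidComputer.PalasekTowerRegisterGlobalFirstHitting
import Summits.NavierStokesRegularity.FluidComputer.PalasekTowerRegisterQuiet

/-!
# REGISTER v2.3′: first hitting AT EVERY HAND-OVER — the anchor calculus inside each growth window

Cell `ns-blowup`, seat `ns-blowup-fc-prover-3` (g2; prover; D-0074 GROUP C/E «BRIDGE SUPPORT»;
bears_on LADDER-NS N1, route `PalasekTowerBreakdown`, child crux item stmt-NavierStokesRegularity-19249
`HeredityAtOne`, sibling 19250 `HeredityFromTwo`, parent 19178 — supports only, nothing claimed or
closed). Companion of `PalasekTowerRegisterGlobalFirstHitting.lean` (p417307, ecbridge-4 g0: the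
anchor calculus AT THE FIRST READOUT `τ₀`, where the GLOBAL ANCHOR makes `τ₀` a first-hitting time of
the speed `c₁ Y₀`) and of `PalasekTowerStageSmoothness.lean` (this seat: every stage is uniformly
smooth, slices vanish at infinity, speed maxima are attained). LABEL: E–C typing (KERNEL lemmas about
the typed register; every statement PROVED; no `Prop` introduced, no named fact). WHAT THIS IS NOT:
not Navier–Stokes evidence — no stage, host, tower or flow is constructed or claimed; the lemmas say
what EVERY registered stage must do INSIDE each growth window `(τ_j, τ_{j+1}]`, they do not say that
one exists, and they decide no stub (`ContinuationEnvelopeAt`, `ReadoutFloorsAt`, `Capture`, …).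

## Why (route text: «each hand-over multiplies the maximal speed by ≥ θ·c₂/c₁ inside the window»)

A stage at level `k` obeys the level-`j` CEILING `‖u‖ ≤ c₂ Y_j` on `[0, τ_j] × ℝ³` and the
level-`(j+1)` FLOOR `c₁ Y_{j+1} ≤ ‖u(τ_{j+1}, x_{j+1})‖` in the ball, for every `j + 1 ≤ k`; under
the separation pin `c₂ Y_j < c₁ Y_{j+1}` (`Schedule.Rigid.sep_wide`, `θ = 6/5 > 1`). So the speed
level `L = c₁ Y_{j+1}` is NOT reached on `[0, τ_j]` and IS reached at `τ_{j+1}`: it is reached for a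
FIRST time `t⋆ ∈ (τ_j, τ_{j+1}]`, at a point `x⋆` which is then a GLOBAL spatial maximum of the speed
with the speed at `x⋆` rising into `t⋆`. There the calculus of p417307 applies verbatim — with one
difference that is the content of this file: `x⋆` is produced by the flow, not registered in the
ball, and at levels `j ≥ 1` of a QUIET schedule the force is ALREADY SILENT at `t⋆`, so the
pressure gradient ALONE must push the fluid through the threshold against viscosity:
`ν |Du(t⋆, x⋆)|² + ⟪u, ∇p⟫(t⋆, x⋆) ≤ 0`.

## What is proved

* §1 (any `ν`, rates, schedule, margins, level) the calculus at a **hitting point** `(t₀, x₀)`,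
  `t₀ ∈ (0, τ_k]`: a global spatial maximum of the speed at `t₀` (`hmax`) which the speed at `x₀`
  never exceeded before (`hpast`): `⟪u, Du·v⟫ = 0` (`inner_fderiv_eq_zero_of_isMax`),
  `⟪u, (u·∇)u⟫ = 0`, `0 ≤ ⟪u, ∂ₜu⟫` within the slab (`inner_timeDeriv_nonneg_of_past`),
  `⟪u, ∇p⟫ ≤ ν⟪u, Δu⟫ + ⟪u, f⟫`, `⟪u, Δu⟫ ≤ −|Du|²` (Frobenius), hence for `ν ≥ 0` the
  **HITTING INEQUALITY** `ν |Du|² + ⟪u, ∇p⟫ ≤ ⟪u, f⟫` (`hitting_inequality`); with the window force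
  budget `push_small`: `… ≤ ‖u(t₀, x₀)‖ · c₄ Y_j` for `t₀ ∈ [τ_j, τ_{j+1}]`
  (`hitting_inequality_push`); for a QUIET schedule and `τ_1 ≤ t₀`: `ν |Du|² + ⟪u, ∇p⟫ ≤ 0`
  (`hitting_inequality_quiet`).
* §2 **existence of the first hitting in each window, given uniform spatial decay of the slab**
  (`hdec : ∃ ρ, ∀ t ∈ [0, τ_k], ∀ x, ρ ≤ ‖x‖ → ‖u t x‖ < L` — the super-level set `{‖u‖ ≥ L}` of the
  slab is bounded; discharged for every stage with `ν > 0` by this seat's tightness file, and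
  trivially true for flows supported in a fixed ball): for `j + 1 ≤ k` and `c₂ Y_j < L`,
  `L ≤ ‖u(τ_{j+1}, x)‖` somewhere, there are `t⋆ ∈ (τ_j, τ_{j+1}]` and `x⋆` with
  `‖u(t⋆, x⋆)‖ = L`, `‖u(t⋆, ·)‖ ≤ L` everywhere and `‖u‖ < L` on `[0, t⋆) × ℝ³`
  (`exists_firstHitting_of_decay`: compactness of `[0, τ_k] × B̄(0, ρ)`, `sInf` of the closed set
  of hitting times, left-continuity of time lines).
* §3 **packaged, at the registered threshold `L = c₁ Y_{j+1}`** (`exists_window_firstHitting`): under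
  `hdec` every stage with `c₂ Y_j < c₁ Y_{j+1}` has, in each window `(τ_j, τ_{j+1}]`, `j + 1 ≤ k`, a
  first-hitting point of the next floor speed where all of §1 holds, the force term bounded by
  `c₁ c₄ Y_{j+1} Y_j`; for QUIET schedules and `j ≥ 1` the force term is ZERO
  (`exists_window_firstHitting_quiet`). Rigid wide schedules satisfy the separation hypothesis
  (`Schedule.Rigid.ceiling_lt_floor_wide`, to be passed as `hsep`).

Reading (`TowerRates.wide`, `Rigid`): in window `1 → 2` the maximal speed crosses `c₁ Y₂ ≈ 6.1·10³`
from `≤ c₂ Y₁ ≈ 4.6·10³`, force-free, within `τ₂ − τ₁ ≈ 5.5·10⁻⁵`; at the crossing instant the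
pressure gradient works against the viscous rate `|Du|²` at the argmax. No stage is claimed to exist.

References: S. Palasek, arXiv:2605.13827 §3.3, §4 [cite: Palasek2026ElementaryModel, §3.3]; D. Gilbarg,
N. Trudinger, *Elliptic PDE*, §3.1 [cite: GilbargTrudinger2001, §3.1]; T.-P. Tsai, ARMA 143 (1998) [cite: Tsai1998, Lemma 3.1].
-/

noncomputable section

namespace Summit.NavierStokesRegularity.FluidComputer.PalasekTowerClayBridge

open Set MeasureTheory Filter Topology Function Real
open scoped ENNReal ContDiff NNReal InnerProductSpace RealInnerProductSpace
open Laplacian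
open Literature.Analysis.FluidPDE

/-- Under rigidity on the wide-base rates the level-`j` ceiling is STRICTLY below the level-`(j+1)`
floor: `c₂ Y_j < c₁ Y_{j+1}` (`(6/5)·c₂ Y_j ≤ c₁ Y_{j+1}` and `c₂ Y_j > 0`). [folklore] -/
theorem Schedule.Rigid.ceiling_lt_floor_wide {S : Schedule TowerRates.wide} (h : S.Rigid) (j : ℕ) :
    S.c₂ * TowerRates.wide.Y j < S.c₁ * TowerRates.wide.Y (j + 1) := by
  have hsep := h.sep_wide j
  have hY : 0 < TowerRates.wide.Y j := Real.rpow_pos_of_pos (TowerRates.wide.N_pos j) _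
  have hc₂ : 0 < S.c₂ := by rw [h.c₂_eq]; norm_num
  have hpos : 0 < S.c₂ * TowerRates.wide.Y j := mul_pos hc₂ hY
  linarith

namespace Stage

variable {ν : ℝ} {R : TowerRates} {S : Schedule R} {m : Margins R} {k : ℕ}

/-! ## §1 The calculus at a hitting point of a speed level -/

/-- A global spatial maximum of the speed is a local maximum of the squared speed. [folklore] -/
theorem isLocalMax_normSq_of_isMax (s : Stage ν R S m k) {t₀ : ℝ} {x₀ : EuclideanSpace ℝ (Fin 3)}
    (hmax : ∀ x, ‖s.u t₀ x‖ ≤ ‖s.u t₀ x₀‖) :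
    IsLocalMax (fun x => ‖s.u t₀ x‖ ^ 2) x₀ :=
  Filter.Eventually.of_forall fun x => pow_le_pow_left₀ (norm_nonneg _) (hmax x) 2

/-- … and of the speed written as `⟪u, u⟫`. [folklore] -/
theorem isLocalMax_inner_self_of_isMax (s : Stage ν R S m k) {t₀ : ℝ}
    {x₀ : EuclideanSpace ℝ (Fin 3)} (hmax : ∀ x, ‖s.u t₀ x‖ ≤ ‖s.u t₀ x₀‖) :
    IsLocalMax (fun x => ⟪s.u t₀ x, s.u t₀ x⟫) x₀ := by
  simpa only [real_inner_self_eq_norm_sq] using s.isLocalMax_normSq_of_isMax hmax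

/-- **Spatial first-order condition at a speed maximum**: `⟪u, Du·v⟫ (t₀, x₀) = 0` for every
direction `v`. [folklore] -/
theorem inner_fderiv_eq_zero_of_isMax (s : Stage ν R S m k) {t₀ : ℝ} (ht₀ : t₀ ∈ Icc 0 (S.τ k))
    {x₀ : EuclideanSpace ℝ (Fin 3)} (hmax : ∀ x, ‖s.u t₀ x‖ ≤ ‖s.u t₀ x₀‖)
    (v : EuclideanSpace ℝ (Fin 3)) :
    ⟪s.u t₀ x₀, fderiv ℝ (s.u t₀) x₀ v⟫ = 0 := by
  set U := s.u t₀ with hU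
  have hC1 : ContDiff ℝ 1 U := (s.classical.contDiff_velocity ht₀).of_le (by norm_cast)
  have hd : HasFDerivAt U (fderiv ℝ U x₀) x₀ := (hC1.differentiable one_ne_zero x₀).hasFDerivAt
  have hsq := hd.norm_sq
  have h0 := (s.isLocalMax_normSq_of_isMax hmax).hasFDerivAt_eq_zero hsq
  rw [two_nsmul] at h0
  have h2 := congrArg (fun L : EuclideanSpace ℝ (Fin 3) →L[ℝ] ℝ => L v) h0
  simp only [add_apply, ContinuousLinearMap.comp_apply, innerSL_apply_apply,
    zero_apply] at h2
  linarith

/-- **No self-advection of speed at a speed maximum**: `⟪u, (u·∇)u⟫ (t₀, x₀) = 0`. [folklore] -/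
theorem inner_convect_eq_zero_of_isMax (s : Stage ν R S m k) {t₀ : ℝ} (ht₀ : t₀ ∈ Icc 0 (S.τ k))
    {x₀ : EuclideanSpace ℝ (Fin 3)} (hmax : ∀ x, ‖s.u t₀ x‖ ≤ ‖s.u t₀ x₀‖) :
    ⟪s.u t₀ x₀, convect (s.u t₀) (s.u t₀) x₀⟫ = 0 := by
  rw [convect_apply]
  exact s.inner_fderiv_eq_zero_of_isMax ht₀ hmax _

/-- **Temporal first-order condition at a hitting point**: if the speed at `x₀` never exceeded its
value at `t₀ ∈ (0, τ_k]` at earlier times of the slab, the one-sided time derivative within the slab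
satisfies `0 ≤ ⟪u, ∂ₜu⟫ (t₀, x₀)` (the squared speed along the time line has a local maximum on
`[0, t₀]` at `t₀`, whose positive tangent cone contains `−1`). [folklore] -/
theorem inner_timeDeriv_nonneg_of_past (s : Stage ν R S m k) {t₀ : ℝ} (ht₀ : t₀ ∈ Ioc 0 (S.τ k))
    {x₀ : EuclideanSpace ℝ (Fin 3)} (hpast : ∀ t ∈ Ico 0 t₀, ‖s.u t x₀‖ ≤ ‖s.u t₀ x₀‖) :
    0 ≤ ⟪s.u t₀ x₀, timeDerivWithin (Icc 0 (S.τ k)) s.u t₀ x₀⟫ := by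
  have ht₀' : t₀ ∈ Icc 0 (S.τ k) := ⟨ht₀.1.le, ht₀.2⟩
  set D := timeDerivWithin (Icc 0 (S.τ k)) s.u t₀ x₀ with hD
  have hline : HasDerivWithinAt (fun t => s.u t x₀) D (Icc 0 (S.τ k)) t₀ := by
    have h := (s.classical.smooth_velocity.differentiableWithinAt_time ht₀' x₀).hasDerivWithinAt
    simpa only [hD, timeDerivWithin_apply] using h
  have hsq : HasDerivWithinAt (fun t => ‖s.u t x₀‖ ^ 2) (2 * ⟪s.u t₀ x₀, D⟫) (Icc 0 t₀) t₀ :=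
    hline.norm_sq.mono (Icc_subset_Icc_right ht₀.2)
  have hmax : IsLocalMaxOn (fun t => ‖s.u t x₀‖ ^ 2) (Icc 0 t₀) t₀ := by
    refine eventually_nhdsWithin_of_forall fun t ht => ?_
    show ‖s.u t x₀‖ ^ 2 ≤ ‖s.u t₀ x₀‖ ^ 2
    rcases ht.2.eq_or_lt with h | h
    · rw [h]
    · exact pow_le_pow_left₀ (norm_nonneg _) (hpast t ⟨ht.1, h⟩) 2
  have hy : (0 : ℝ) - t₀ ∈ posTangentConeAt (Icc 0 t₀) t₀ := by
    apply sub_mem_posTangentConeAt_of_segment_subset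
    rw [segment_symm, segment_eq_Icc ht₀.1.le]
  have hle := hmax.hasFDerivWithinAt_nonpos hsq.hasFDerivWithinAt hy
  simp only [ContinuousLinearMap.toSpanSingleton_apply, smul_eq_mul] at hle
  by_contra hneg
  have hneg' : ⟪s.u t₀ x₀, D⟫ < 0 := lt_of_not_ge hneg
  have h0 : 0 < t₀ := ht₀.1
  have : 0 < (0 - t₀) * (2 * ⟪s.u t₀ x₀, D⟫) := mul_pos_of_neg_of_neg (by linarith) (by linarith)
  linarith

/-- **Pressure must drive the hitting**: at a hitting point, `⟪u, ∇p⟫ ≤ ν ⟪u, Δu⟫ + ⟪u, f⟫`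
(momentum equation, `⟪u, ∂ₜu⟫ ≥ 0`, `⟪u, (u·∇)u⟫ = 0`). [cite: Palasek2026ElementaryModel, §3.3] -/
theorem inner_gradient_le_of_hitting (s : Stage ν R S m k) {t₀ : ℝ} (ht₀ : t₀ ∈ Ioc 0 (S.τ k))
    {x₀ : EuclideanSpace ℝ (Fin 3)} (hmax : ∀ x, ‖s.u t₀ x‖ ≤ ‖s.u t₀ x₀‖)
    (hpast : ∀ t ∈ Ico 0 t₀, ‖s.u t x₀‖ ≤ ‖s.u t₀ x₀‖) :
    ⟪s.u t₀ x₀, gradient (s.p t₀) x₀⟫ ≤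
      ν * ⟪s.u t₀ x₀, Δ (s.u t₀) x₀⟫ + ⟪s.u t₀ x₀, S.f t₀ x₀⟫ := by
  have ht₀' : t₀ ∈ Icc 0 (S.τ k) := ⟨ht₀.1.le, ht₀.2⟩
  have hmom := s.classical.momentum t₀ ht₀' x₀
  have hD : timeDerivWithin (Icc 0 (S.τ k)) s.u t₀ x₀ =
      ν • Δ (s.u t₀) x₀ - gradient (s.p t₀) x₀ + S.f t₀ x₀ - convect (s.u t₀) (s.u t₀) x₀ := by
    rw [← hmom]; abel
  have h1 := s.inner_timeDeriv_nonneg_of_past ht₀ hpast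
  rw [hD, inner_sub_right, inner_add_right, inner_sub_right, real_inner_smul_right,
    s.inner_convect_eq_zero_of_isMax ht₀' hmax] at h1
  linarith

/-- **Second-order condition at a speed maximum**: `⟪u, Δu⟫ (t₀, x₀) ≤ −|Du (t₀, x₀)|²` (Frobenius
norm), from `Δ‖u‖² ≤ 0` at the maximum and `Δ|U|² = 2⟪ΔU, U⟫ + 2|DU|²`.
[cite: GilbargTrudinger2001, §3.1] [cite: Tsai1998, Lemma 3.1] -/
theorem inner_laplacian_le_of_isMax (s : Stage ν R S m k) {t₀ : ℝ} (ht₀ : t₀ ∈ Icc 0 (S.τ k))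
    {x₀ : EuclideanSpace ℝ (Fin 3)} (hmax : ∀ x, ‖s.u t₀ x‖ ≤ ‖s.u t₀ x₀‖) :
    ⟪s.u t₀ x₀, Δ (s.u t₀) x₀⟫ ≤ - frobeniusNormSq (fderiv ℝ (s.u t₀) x₀) := by
  set U := s.u t₀ with hU
  have hC2 : ContDiff ℝ 2 U := (s.classical.contDiff_velocity ht₀).of_le (by norm_cast)
  have hΔ : (Δ fun y => ⟪U y, U y⟫) x₀ ≤ 0 :=
    laplacian_nonpos_of_isLocalMax (hC2.inner ℝ hC2) (s.isLocalMax_inner_self_of_isMax hmax)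
  rw [laplacian_inner_self_eq hC2 x₀, real_inner_comm] at hΔ
  linarith

/-- **THE HITTING INEQUALITY.** For `ν ≥ 0`, at a hitting point `(t₀, x₀)`, `t₀ ∈ (0, τ_k]` (global
spatial maximum of the speed at `t₀`, never exceeded at `x₀` before), every stage satisfies
`ν |Du|² + ⟪u, ∇p⟫ ≤ ⟪u, f⟫` at `(t₀, x₀)`: the pressure gradient accelerates the fluid through the
level at least at the local viscous rate, up to the force. The `τ₀` case with the registered floor
point is p417307's `anchor_inequality`. [cite: Palasek2026ElementaryModel, §3.3] -/
theorem hitting_inequality (s : Stage ν R S m k) (hν : 0 ≤ ν) {t₀ : ℝ} (ht₀ : t₀ ∈ Ioc 0 (S.τ k))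
    {x₀ : EuclideanSpace ℝ (Fin 3)} (hmax : ∀ x, ‖s.u t₀ x‖ ≤ ‖s.u t₀ x₀‖)
    (hpast : ∀ t ∈ Ico 0 t₀, ‖s.u t x₀‖ ≤ ‖s.u t₀ x₀‖) :
    ν * frobeniusNormSq (fderiv ℝ (s.u t₀) x₀) + ⟪s.u t₀ x₀, gradient (s.p t₀) x₀⟫ ≤
      ⟪s.u t₀ x₀, S.f t₀ x₀⟫ := by
  have h1 := s.inner_gradient_le_of_hitting ht₀ hmax hpast
  have h2 := s.inner_laplacian_le_of_isMax ⟨ht₀.1.le, ht₀.2⟩ hmax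
  have h3 : ν * ⟪s.u t₀ x₀, Δ (s.u t₀) x₀⟫ ≤ ν * (- frobeniusNormSq (fderiv ℝ (s.u t₀) x₀)) :=
    mul_le_mul_of_nonneg_left h2 hν
  linarith

/-- The window force does work at rate at most `‖u (t₀, x₀)‖ · c₄ Y_j` at a point of the growth
window `[τ_j, τ_{j+1}]` (`push_small`, Cauchy–Schwarz). [folklore] -/
theorem inner_force_le_of_window (s : Stage ν R S m k) {j : ℕ} {t₀ : ℝ}
    (ht₀ : t₀ ∈ Icc (S.τ j) (S.τ (j + 1))) (x₀ : EuclideanSpace ℝ (Fin 3)) :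
    ⟪s.u t₀ x₀, S.f t₀ x₀⟫ ≤ ‖s.u t₀ x₀‖ * (S.c₄ * R.Y j) :=
  (real_inner_le_norm _ _).trans
    (mul_le_mul_of_nonneg_left (S.push_small j t₀ ht₀ x₀) (norm_nonneg _))

/-- **The hitting inequality with the window force budget**: at a hitting point inside the growth
window `[τ_j, τ_{j+1}]`, `ν |Du|² + ⟪u, ∇p⟫ ≤ ‖u(t₀, x₀)‖ · c₄ Y_j` (`ν ≥ 0`).
[cite: Palasek2026ElementaryModel, §3.3] -/
theorem hitting_inequality_push (s : Stage ν R S m k) (hν : 0 ≤ ν) {j : ℕ} {t₀ : ℝ}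
    (ht₀ : t₀ ∈ Ioc 0 (S.τ k)) (hwin : t₀ ∈ Icc (S.τ j) (S.τ (j + 1)))
    {x₀ : EuclideanSpace ℝ (Fin 3)} (hmax : ∀ x, ‖s.u t₀ x‖ ≤ ‖s.u t₀ x₀‖)
    (hpast : ∀ t ∈ Ico 0 t₀, ‖s.u t x₀‖ ≤ ‖s.u t₀ x₀‖) :
    ν * frobeniusNormSq (fderiv ℝ (s.u t₀) x₀) + ⟪s.u t₀ x₀, gradient (s.p t₀) x₀⟫ ≤
      ‖s.u t₀ x₀‖ * (S.c₄ * R.Y j) :=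
  (s.hitting_inequality hν ht₀ hmax hpast).trans (s.inner_force_le_of_window hwin x₀)

/-- **The hitting inequality at a SILENT time**: for a quiet schedule (`f = 0` from `τ_1` on) and a
hitting point with `τ_1 ≤ t₀`, `ν |Du|² + ⟪u, ∇p⟫ ≤ 0` at `(t₀, x₀)` — the pressure gradient alone
accelerates the fluid through the level, against viscosity (`ν ≥ 0`). [cite: Palasek2026ElementaryModel, §4] -/
theorem hitting_inequality_quiet (s : Stage ν R S m k) (hν : 0 ≤ ν) (hQ : S.Quiet) {t₀ : ℝ}
    (ht₀ : t₀ ∈ Ioc 0 (S.τ k)) (h1 : S.τ 1 ≤ t₀)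
    {x₀ : EuclideanSpace ℝ (Fin 3)} (hmax : ∀ x, ‖s.u t₀ x‖ ≤ ‖s.u t₀ x₀‖)
    (hpast : ∀ t ∈ Ico 0 t₀, ‖s.u t x₀‖ ≤ ‖s.u t₀ x₀‖) :
    ν * frobeniusNormSq (fderiv ℝ (s.u t₀) x₀) + ⟪s.u t₀ x₀, gradient (s.p t₀) x₀⟫ ≤ 0 := by
  have h := s.hitting_inequality hν ht₀ hmax hpast
  rwa [hQ.apply h1 x₀, inner_zero_right] at h

/-! ## §2 Existence of the first hitting of a level, given uniform spatial decay on the slab -/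

/-- Time lines of a stage are continuous from the left within the slab: a bound `‖u t x‖ ≤ L` valid
for all `t ∈ [0, t₀)` persists at `t₀ ∈ (0, τ_k]`. [folklore] -/
theorem norm_le_of_forall_lt (s : Stage ν R S m k) {t₀ : ℝ} (ht₀ : t₀ ∈ Ioc 0 (S.τ k))
    (x : EuclideanSpace ℝ (Fin 3)) {L : ℝ} (h : ∀ t ∈ Ico 0 t₀, ‖s.u t x‖ ≤ L) :
    ‖s.u t₀ x‖ ≤ L := by
  have ht₀' : t₀ ∈ Icc 0 (S.τ k) := ⟨ht₀.1.le, ht₀.2⟩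
  have hcont : ContinuousWithinAt (fun t => ‖s.u t x‖) (Ico 0 t₀) t₀ :=
    ((s.continuousWithinAt_timeLine ht₀' x).norm).mono fun t ht => ⟨ht.1, ht.2.le.trans ht₀.2⟩
  haveI hne : (𝓝[Ico 0 t₀] t₀).NeBot := by
    refine mem_closure_iff_nhdsWithin_neBot.1 ?_
    rw [closure_Ico ht₀.1.ne]
    exact right_mem_Icc.2 ht₀.1.le
  exact le_of_tendsto hcont (eventually_nhdsWithin_of_forall h)

/-- **First hitting of a speed level, given uniform spatial decay.** Let `L` be a speed level that is
NOT reached on `[0, T₁] × ℝ³` (`T₁ ∈ [0, τ_k]`), IS reached at some slab time `T₂ ≥ T₁` somewhere,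
and is reached on the slab only inside a fixed ball (`hdec`: `ρ ≤ ‖x‖ → ‖u t x‖ < L`). Then there
is a FIRST hitting time `t⋆ ∈ (T₁, T₂]` with a hitting point `x⋆`: `‖u(t⋆, x⋆)‖ = L`,
`‖u(t⋆, ·)‖ ≤ L` everywhere, `‖u‖ < L` on `[0, t⋆) × ℝ³` (compactness of `[0, τ_k] × B̄(0, ρ)`: the
set of slab times at which the level is reached in the ball is closed and nonempty; its infimum is
attained; left-continuity of time lines gives the bound at `t⋆`). [folklore] -/
theorem exists_firstHitting_of_decay (s : Stage ν R S m k) {L T₁ T₂ : ℝ}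
    (hT₁ : T₁ ∈ Icc 0 (S.τ k)) (hT₁₂ : T₁ ≤ T₂) (hT₂ : T₂ ≤ S.τ k)
    (hbefore : ∀ t ∈ Icc 0 T₁, ∀ x, ‖s.u t x‖ < L)
    (hreach : ∃ x, L ≤ ‖s.u T₂ x‖)
    (hdec : ∃ ρ : ℝ, ∀ t ∈ Icc 0 (S.τ k), ∀ x : EuclideanSpace ℝ (Fin 3), ρ ≤ ‖x‖ → ‖s.u t x‖ < L) :
    ∃ t₀ ∈ Ioc T₁ T₂, ∃ x₀ : EuclideanSpace ℝ (Fin 3),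
      ‖s.u t₀ x₀‖ = L ∧ (∀ x, ‖s.u t₀ x‖ ≤ L) ∧ (∀ t ∈ Ico 0 t₀, ∀ x, ‖s.u t x‖ < L) := by
  obtain ⟨ρ, hρ⟩ := hdec
  -- the compact box and the closed set of hitting points inside it
  set D : Set (ℝ × EuclideanSpace ℝ (Fin 3)) :=
    Icc (0 : ℝ) (S.τ k) ×ˢ Metric.closedBall (0 : EuclideanSpace ℝ (Fin 3)) ρ with hDdef
  have hDc : IsCompact D := isCompact_Icc.prod (isCompact_closedBall _ _)
  have hDcl : IsClosed D := isClosed_Icc.prod Metric.isClosed_closedBall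
  have hcont : ContinuousOn (fun z : ℝ × EuclideanSpace ℝ (Fin 3) => ‖uncurry s.u z‖) D :=
    (s.classical.smooth_velocity.continuousOn.mono (prod_mono le_rfl (subset_univ _))).norm
  set K : Set (ℝ × EuclideanSpace ℝ (Fin 3)) :=
    D ∩ (fun z : ℝ × EuclideanSpace ℝ (Fin 3) => ‖uncurry s.u z‖) ⁻¹' Ici L with hKdef
  have hKcl : IsClosed K := hcont.preimage_isClosed_of_isClosed hDcl isClosed_Ici
  have hKc : IsCompact K := hDc.of_isClosed_subset hKcl inter_subset_left
  -- the set of hitting times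
  set A : Set ℝ := Prod.fst '' K with hAdef
  have hAcl : IsClosed A := (hKc.image continuous_fst).isClosed
  have hAbdd : BddBelow A := ⟨0, fun t ht => by
    obtain ⟨z, hz, rfl⟩ := ht
    exact hz.1.1.1⟩
  -- every hitting point of the slab lies in the box (decay), so `T₂ ∈ A`
  have hmemK : ∀ t ∈ Icc 0 (S.τ k), ∀ x, L ≤ ‖s.u t x‖ → (t, x) ∈ K := by
    intro t ht x hx
    have hxρ : ‖x‖ ≤ ρ := by
      by_contra hlt
      exact absurd hx (not_le.2 (hρ t ht x (le_of_not_ge hlt)))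
    refine ⟨⟨ht, ?_⟩, ?_⟩
    · rwa [Metric.mem_closedBall, dist_zero_right]
    · simpa using hx
  have hT₂0 : 0 ≤ T₂ := hT₁.1.trans hT₁₂
  have hT₂A : T₂ ∈ A := by
    obtain ⟨x, hx⟩ := hreach
    exact ⟨(T₂, x), hmemK T₂ ⟨hT₂0, hT₂⟩ x hx, rfl⟩
  have hAne : A.Nonempty := ⟨T₂, hT₂A⟩
  -- the first hitting time
  have ht₀A : sInf A ∈ A := hAcl.csInf_mem hAne hAbdd
  obtain ⟨⟨t', x₀⟩, hzK, hzt⟩ := ht₀A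
  simp only at hzt
  have ht₀slab : t' ∈ Icc 0 (S.τ k) := hzK.1.1
  have hx₀ : L ≤ ‖s.u t' x₀‖ := by simpa using hzK.2
  have ht₀T₂ : t' ≤ T₂ := by rw [hzt]; exact csInf_le hAbdd hT₂A
  -- strictly after `T₁`
  have hT₁t₀ : T₁ < t' := by
    by_contra hle
    exact absurd hx₀ (not_le.2 (hbefore t' ⟨ht₀slab.1, le_of_not_gt hle⟩ x₀))
  have ht₀pos : 0 < t' := lt_of_le_of_lt hT₁.1 hT₁t₀
  -- before `t₀` the level is not reached anywhere
  have hstrict : ∀ t ∈ Ico 0 t', ∀ x, ‖s.u t x‖ < L := by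
    intro t ht x
    by_contra hge
    have hge' : L ≤ ‖s.u t x‖ := le_of_not_gt hge
    have htA : t ∈ A := ⟨(t, x), hmemK t ⟨ht.1, ht.2.le.trans ht₀slab.2⟩ x hge', rfl⟩
    have h1 : sInf A ≤ t := csInf_le hAbdd htA
    rw [← hzt] at h1
    exact absurd h1 (not_le.2 ht.2)
  -- at `t₀` the level bounds the speed everywhere (left-continuity)
  have hle : ∀ x, ‖s.u t' x‖ ≤ L := fun x =>
    s.norm_le_of_forall_lt ⟨ht₀pos, ht₀slab.2⟩ x fun t ht => (hstrict t ht x).le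
  exact ⟨t', ⟨hT₁t₀, ht₀T₂⟩, x₀, le_antisymm (hle x₀) hx₀, hle, hstrict⟩

/-! ## §3 The first hitting of the next floor speed in each growth window -/

/-- **FIRST HITTING AT THE HAND-OVER `j → j+1` (given uniform spatial decay).** Let `s` be a stage at
level `k`, `j + 1 ≤ k`, with the separation `c₂ Y_j < c₁ Y_{j+1}` (rigid wide schedules:
`Schedule.Rigid.ceiling_lt_floor_wide`), whose speed reaches the floor level `c₁ Y_{j+1}` on the slab
only inside a fixed ball (`hdec`). Then the level `c₁ Y_{j+1}` is reached for the FIRST time at some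
`t⋆ ∈ (τ_j, τ_{j+1}]`, at a point `x⋆` where: the speed equals `c₁ Y_{j+1}` and is globally maximal,
the speed was `< c₁ Y_{j+1}` everywhere on `[0, t⋆)`, `⟪u, Du·v⟫ = 0` for all `v`,
`0 ≤ ⟪u, ∂ₜu⟫` within the slab, and (for `ν ≥ 0`) the hitting inequality
`ν |Du|² + ⟪u, ∇p⟫ ≤ ⟪u, f⟫ ≤ c₁ c₄ Y_{j+1} Y_j` holds. A necessary condition on every registered
stage; no instance is claimed. [cite: Palasek2026ElementaryModel, §3.3] -/
theorem exists_window_firstHitting (s : Stage ν R S m k) (hν : 0 ≤ ν) {j : ℕ} (hj : j + 1 ≤ k)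
    (hsep : S.c₂ * R.Y j < S.c₁ * R.Y (j + 1))
    (hdec : ∃ ρ : ℝ, ∀ t ∈ Icc 0 (S.τ k), ∀ x : EuclideanSpace ℝ (Fin 3),
      ρ ≤ ‖x‖ → ‖s.u t x‖ < S.c₁ * R.Y (j + 1)) :
    ∃ t₀ ∈ Ioc (S.τ j) (S.τ (j + 1)), ∃ x₀ : EuclideanSpace ℝ (Fin 3),
      ‖s.u t₀ x₀‖ = S.c₁ * R.Y (j + 1) ∧
      (∀ x, ‖s.u t₀ x‖ ≤ S.c₁ * R.Y (j + 1)) ∧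
      (∀ t ∈ Ico 0 t₀, ∀ x, ‖s.u t x‖ < S.c₁ * R.Y (j + 1)) ∧
      (∀ v, ⟪s.u t₀ x₀, fderiv ℝ (s.u t₀) x₀ v⟫ = 0) ∧
      0 ≤ ⟪s.u t₀ x₀, timeDerivWithin (Icc 0 (S.τ k)) s.u t₀ x₀⟫ ∧
      ν * frobeniusNormSq (fderiv ℝ (s.u t₀) x₀) + ⟪s.u t₀ x₀, gradient (s.p t₀) x₀⟫ ≤
        ⟪s.u t₀ x₀, S.f t₀ x₀⟫ ∧
      ν * frobeniusNormSq (fderiv ℝ (s.u t₀) x₀) + ⟪s.u t₀ x₀, gradient (s.p t₀) x₀⟫ ≤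
        S.c₁ * S.c₄ * R.Y (j + 1) * R.Y j := by
  have hτj : S.τ j ∈ Icc 0 (S.τ k) := ⟨(S.τ_pos j).le, S.τ_mono ((Nat.le_succ j).trans hj)⟩
  have hbefore : ∀ t ∈ Icc 0 (S.τ j), ∀ x, ‖s.u t x‖ < S.c₁ * R.Y (j + 1) :=
    fun t ht x => lt_of_le_of_lt (s.ceiling j ((Nat.le_succ j).trans hj) t ht x) hsep
  have hreach : ∃ x, S.c₁ * R.Y (j + 1) ≤ ‖s.u (S.τ (j + 1)) x‖ :=
    let ⟨x, _, hx⟩ := s.floor (j + 1) hj; ⟨x, hx⟩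
  obtain ⟨t₀, ht₀, x₀, heq, hle, hstrict⟩ :=
    s.exists_firstHitting_of_decay hτj (S.τ_lt_succ j).le (S.τ_mono hj) hbefore hreach hdec
  have ht₀' : t₀ ∈ Ioc 0 (S.τ k) := ⟨(S.τ_pos j).trans ht₀.1, ht₀.2.trans (S.τ_mono hj)⟩
  have hmax : ∀ x, ‖s.u t₀ x‖ ≤ ‖s.u t₀ x₀‖ := fun x => (hle x).trans heq.ge
  have hpast : ∀ t ∈ Ico 0 t₀, ‖s.u t x₀‖ ≤ ‖s.u t₀ x₀‖ :=
    fun t ht => (hstrict t ht x₀).le.trans heq.ge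
  have hwin : t₀ ∈ Icc (S.τ j) (S.τ (j + 1)) := ⟨ht₀.1.le, ht₀.2⟩
  have hineq := s.hitting_inequality hν ht₀' hmax hpast
  refine ⟨t₀, ht₀, x₀, heq, hle, hstrict, s.inner_fderiv_eq_zero_of_isMax ⟨ht₀'.1.le, ht₀'.2⟩ hmax,
    s.inner_timeDeriv_nonneg_of_past ht₀' hpast, hineq, ?_⟩
  have hf := s.inner_force_le_of_window hwin x₀
  rw [heq] at hf
  have hY : 0 < R.Y j := Real.rpow_pos_of_pos (R.N_pos j) _
  calc ν * frobeniusNormSq (fderiv ℝ (s.u t₀) x₀) + ⟪s.u t₀ x₀, gradient (s.p t₀) x₀⟫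
      ≤ ⟪s.u t₀ x₀, S.f t₀ x₀⟫ := hineq
    _ ≤ S.c₁ * R.Y (j + 1) * (S.c₄ * R.Y j) := hf
    _ = S.c₁ * S.c₄ * R.Y (j + 1) * R.Y j := by ring

/-- **FIRST HITTING AT A SILENT HAND-OVER** (`j ≥ 1`, quiet schedule, given uniform spatial decay):
the floor speed `c₁ Y_{j+1}` is first reached at `t⋆ ∈ (τ_j, τ_{j+1}] ⊆ [τ_1, ∞)`, where the force
vanishes, so at the hitting point `ν |Du|² + ⟪u, ∇p⟫ ≤ 0`: the pressure gradient ALONE pushes the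
fluid through the next floor speed. This is the kernel form of «autonomous heredity» at the instant
of crossing, for every registered stage; no instance is claimed. [cite: Palasek2026ElementaryModel, §4] -/
theorem exists_window_firstHitting_quiet (s : Stage ν R S m k) (hν : 0 ≤ ν) (hQ : S.Quiet)
    {j : ℕ} (hj1 : 1 ≤ j) (hj : j + 1 ≤ k) (hsep : S.c₂ * R.Y j < S.c₁ * R.Y (j + 1))
    (hdec : ∃ ρ : ℝ, ∀ t ∈ Icc 0 (S.τ k), ∀ x : EuclideanSpace ℝ (Fin 3),
      ρ ≤ ‖x‖ → ‖s.u t x‖ < S.c₁ * R.Y (j + 1)) :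
    ∃ t₀ ∈ Ioc (S.τ j) (S.τ (j + 1)), ∃ x₀ : EuclideanSpace ℝ (Fin 3),
      ‖s.u t₀ x₀‖ = S.c₁ * R.Y (j + 1) ∧
      (∀ x, ‖s.u t₀ x‖ ≤ S.c₁ * R.Y (j + 1)) ∧
      (∀ t ∈ Ico 0 t₀, ∀ x, ‖s.u t x‖ < S.c₁ * R.Y (j + 1)) ∧
      0 ≤ ⟪s.u t₀ x₀, timeDerivWithin (Icc 0 (S.τ k)) s.u t₀ x₀⟫ ∧
      ν * frobeniusNormSq (fderiv ℝ (s.u t₀) x₀) + ⟪s.u t₀ x₀, gradient (s.p t₀) x₀⟫ ≤ 0 := by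
  obtain ⟨t₀, ht₀, x₀, heq, hle, hstrict, -, htime, hineq, -⟩ :=
    s.exists_window_firstHitting hν hj hsep hdec
  refine ⟨t₀, ht₀, x₀, heq, hle, hstrict, htime, ?_⟩
  have h1 : S.τ 1 ≤ t₀ := (S.τ_mono hj1).trans ht₀.1.le
  rwa [hQ.apply h1 x₀, inner_zero_right] at hineq

end Stage

end Summit.NavierStokesRegularity.FluidComputer.PalasekTowerClayBridge

end
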